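import Literature.Probability.LatticeModels.DartPhase
import Literature.Probability.LatticeModels.DirichletGreenFunction
import Literature.Probability.RandomPlanarGeometry.PlanarDomains

/-!
# Vocabulary of the line `kenyon-stream-second-relation` on the crux `ParafermionPrecompact`
# (route `CardySusyWard`, item stmt-CriticalPhenomena-11293) — definitions only

Lead prover `prover-line-stmt-CriticalPhenomena-11293-0`.  This file is the importable home of the
lattice / percolation vocabulary in which the five registered stubs of the picked line are stated
(skeleton `Cruxes/ParafermionPrecompact/Lines/kenyon-stream-second-relation.lean`, planner
`planner-cruxplan-stmt-CriticalPhenomena-11293-kenyon-stream-second-0`), so that each stub can be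
landed as its own `Theorems/` file and imported back into the skeleton.  Bodies are VERBATIM those
of the checked skeleton (same namespace as the skeleton, `…Cruxes.ParafermionPrecompact.KenyonStreamSecondRelation`, so
that landed stubs ARE the skeleton's stubs by fully-qualified name); nothing here is an obligation of the item.

* corner classes and their pivots at a genuine medial vertex `s(x, x + eᵢ)` (`ex`, `classOffset`,
  `classComp`, `pivotOf`, `cornersAt`, `mv`);
* the two local residuals of a corner function: the VERTEX residual `vRes` (DCS 2012 Prop. 8.6 /
  Duminil-Copin 2012 Prop. 4, coefficient `c = +i`, clockwise `NW, NE, SE, SW`) and the SUM residual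
  `sRes` (Kenyon–Duffin holomorphy of the stream function, the "second relation");
* the Laplacian-stencil support (`faceA`, `faceB`, `window`, `nearEdges`) and the Green-gradient
  weights `greenWeight`, `greenWeight₂` over the tree's `dirichletGreen`;
* the percolation side: the spin-`1/3` dart field `dartField E` (= `bondDartObservable E E.δ (1/3)`),
  the touch probability `touchProb`, `edgeDepth`, `defectProfile`, the `6δ`-deep sites `deepSet` /
  `deepSites` of a Dobrushin domain, and `κ = (2 cos (π/12))⁻¹`;
* elementary lemmas (finiteness/membership of `deepSites`, window/pivot distance bookkeeping,
  `0 < κ ≤ 1`, nonnegativity of the weights).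

References: H. Duminil-Copin, S. Smirnov, Clay Math. Proc. 15 (2012), §8.3 (Prop. 8.6, Conj. 8.7)
[DuminilCopinSmirnov2012Lattice]; H. Duminil-Copin, J. Phys. A 45 (2012) 494013, Prop. 4
[DuminilCopin2012Parafermion]; R. Kenyon, Invent. Math. 150 (2002) (discrete holomorphy of the
stream function); G. F. Lawler, *Intersections of Random Walks* (1991), §1.4–1.5 [Lawler1991].
-/

noncomputable section

namespace Summit.CriticalPhenomena.CardyFormulaZ2.Cruxes.ParafermionPrecompact.KenyonStreamSecondRelation

open scoped BigOperators Topology Classical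
open Filter Set MeasureTheory
open _root_.Literature.Probability.LatticeModels
open _root_.Literature.Probability.RandomPlanarGeometry (DobrushinDomain)
open _root_.Literature.Probability.Percolation (BondConfig bondPercolation half)

/-! ### Lattice vocabulary: classes, corners, the two local residuals -/

/-- Unit vector `eᵢ` of `ℤ²`. [folklore] -/
def ex (i : Fin 2) : Site 2 := Pi.single i 1

/-- The four corner classes `c_q = f - v ∈ {0, -e₀, -e₀-e₁, -e₁}` of a corner `(v, f)`
(`IsCorner v f`), in the order of the stream-function weights `u = (1, i, -1, -i)` of the card. [folklore] -/
def classOffset : Fin 4 → Site 2 := ![0, -ex 0, -ex 0 - ex 1, -ex 1]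

/-- The class-`q` component of a function on corners: `g_q(v) = Φ(v, v + c_q)`. [folklore] -/
def classComp (Φ : Site 2 × Site 2 → ℂ) (q : Fin 4) (v : Site 2) : ℂ := Φ (v, v + classOffset q)

/-- The pivot (site) of the class-`q` corner incident to the medial vertex `s(x, x + eᵢ)`:
horizontal edge (`i = 0`): classes `0, 3` pivot at `x`, classes `1, 2` at `x + e₀`; vertical edge
(`i = 1`): classes `0, 1` at `x`, classes `2, 3` at `x + e₁`. (Each medial vertex carries exactly
one corner of each class: `(x,x), (x+e₀,x), (x+e₀,x-e₁), (x,x-e₁)` resp.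
`(x,x), (x,x-e₀), (x+e₁,x-e₀), (x+e₁,x)`.) [folklore] -/
def pivotOf (x : Site 2) (i : Fin 2) (q : Fin 4) : Site 2 :=
  if i = 0 then ![x, x + ex 0, x + ex 0, x] q else ![x, x, x + ex 1, x + ex 1] q

/-- The four corners at the medial vertex `s(x, x + eᵢ)` listed CLOCKWISE `NW, NE, SE, SW`
(verbatim the barrier file's `Literature.Barriers.CriticalPhenomena.medialCornersAt`, copied to
keep the import cone of the eventual Theorems file clean). [folklore] -/
def cornersAt (x : Site 2) : Fin 2 → Fin 4 → Site 2 × Site 2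
  | 0 => ![(x, x), (x + ex 0, x), (x + ex 0, x - ex 1), (x, x - ex 1)]
  | 1 => ![(x + ex 1, x - ex 0), (x + ex 1, x), (x, x), (x, x - ex 0)]

/-- The genuine medial vertex (lattice edge) `s(y, y + eᵢ)` indexed by `p = (y, i)`; no `Sym2`
junk can occur in statements quantified over `p : Site 2 × Fin 2`. [folklore] -/
def mv (p : Site 2 × Fin 2) : MedialVertex := s(p.1, p.1 + ex p.2)

/-- VERTEX residual (DCS Prop. 8.6 / Duminil-Copin 2012 Prop. 4 with the tree's certified
coefficient `c = i`, clockwise `NW, NE, SE, SW`): `Φ(NW) - Φ(SE) - i (Φ(NE) - Φ(SW))`. [folklore] -/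
def vRes (Φ : Site 2 × Site 2 → ℂ) (p : Site 2 × Fin 2) : ℂ :=
  Φ (cornersAt p.1 p.2 0) - Φ (cornersAt p.1 p.2 2) -
    Complex.I * (Φ (cornersAt p.1 p.2 1) - Φ (cornersAt p.1 p.2 3))

/-- SUM residual (the card's "second relation" `E(A)+E(C) = E(B)+E(D)`, `A, C` the two darts
pointing to the medial vertex): the alternating clockwise sum `Φ(NW) - Φ(NE) + Φ(SE) - Φ(SW)`. [folklore] -/
def sRes (Φ : Site 2 × Site 2 → ℂ) (p : Site 2 × Fin 2) : ℂ :=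
  Φ (cornersAt p.1 p.2 0) - Φ (cornersAt p.1 p.2 1) + Φ (cornersAt p.1 p.2 2) - Φ (cornersAt p.1 p.2 3)

/-- The two faces (lower-left corners) adjacent to the edge `p = (y, i)`: `y` (above / east) … [folklore] -/
def faceA (p : Site 2 × Fin 2) : Site 2 := p.1

/-- … and `y - e₁` (below) for a horizontal edge, `y - e₀` (west) for a vertical one. [folklore] -/
def faceB (p : Site 2 × Fin 2) : Site 2 := if p.2 = 0 then p.1 - ex 1 else p.1 - ex 0

/-- The 18 edges `(y, j)` with `‖y - x‖_∞ ≤ 1` — the support of the Laplacian stencil at `x`. [folklore] -/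
def window (x : Site 2) : Finset (Site 2 × Fin 2) :=
  (Finset.univ : Finset (Fin 3 × Fin 3 × Fin 2)).image
    fun t => (x + ![((t.1 : ℕ) : ℤ) - 1, ((t.2.1 : ℕ) : ℤ) - 1], t.2.2)

/-- The edges within sup-distance `1` of the finite site set `Λ`. [folklore] -/
def nearEdges (Λ : Finset (Site 2)) : Finset (Site 2 × Fin 2) := Λ.biUnion window

/-- GREEN-GRADIENT WEIGHT of the edge `p = (y,i)` seen from `x₀ ∈ Λ`, class `q`:
`|G_Λ(x₀,y) - G_Λ(x₀,y+eᵢ)| + |G_Λ(x₀, f_p - c_q) - G_Λ(x₀, f'_p - c_q)|` — the moduli of the two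
`G`-differences that multiply `sRes_p` after summation by parts (primal edge and the dual edge
shifted by the class; stencil coefficients have modulus `1/√2 ≤ 1`). `dirichletGreen Λ x₀ ·`
vanishes off `Λ`, so only edges near `Λ` carry weight. [folklore] -/
def greenWeight (Λ : Finset (Site 2)) (x₀ : Site 2) (q : Fin 4) (p : Site 2 × Fin 2) : ℝ :=
  |dirichletGreen Λ x₀ p.1 - dirichletGreen Λ x₀ (p.1 + ex p.2)| +
    |dirichletGreen Λ x₀ (faceA p - classOffset q) - dirichletGreen Λ x₀ (faceB p - classOffset q)|

/-- The same weight for the DIFFERENCE `y ↦ G_Λ(x₀,y) - G_Λ(x₁,y)` (clause (ii)). [folklore] -/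
def greenWeight₂ (Λ : Finset (Site 2)) (x₀ x₁ : Site 2) (q : Fin 4) (p : Site 2 × Fin 2) : ℝ :=
  |(dirichletGreen Λ x₀ p.1 - dirichletGreen Λ x₁ p.1) -
      (dirichletGreen Λ x₀ (p.1 + ex p.2) - dirichletGreen Λ x₁ (p.1 + ex p.2))| +
    |(dirichletGreen Λ x₀ (faceA p - classOffset q) - dirichletGreen Λ x₁ (faceA p - classOffset q)) -
      (dirichletGreen Λ x₀ (faceB p - classOffset q) - dirichletGreen Λ x₁ (faceB p - classOffset q))|

/-! ### Percolation vocabulary: the dart field, touch probabilities, the defect profile -/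

/-- The `q = 1`, spin-`1/3` DART FIELD of the discrete Dobrushin datum `E` at its own mesh:
`Φ_E(v,f) = bondDartObservable E E.δ (1/3) (v,f)` (the tree's edge observable, `DartPhase.lean`). [folklore] -/
def dartField (E : DiscreteDobrushin) : Site 2 × Site 2 → ℂ := fun c => bondDartObservable E E.δ (1 / 3) c

/-- TOUCH PROBABILITY: the `P_{1/2}`-probability that the medial exploration path of `E` visits a
medial vertex within distance `r` of the point `z` (a positive, monotone, phase-free quantity). [folklore] -/
def touchProb (E : DiscreteDobrushin) (z : ℂ) (r : ℝ) : ℝ :=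
  (bondPercolation (zdGraph 2) half).real
    {ω | ∃ e ∈ medialExploration E ω, dist (medialPoint E.δ e) z ≤ r}

/-- The DEPTH of the edge `p` in `E`: distance from its midpoint to the complement of the domain,
floored at one mesh (so that the boundary layer has depth `δ`). [folklore] -/
def edgeDepth (E : DiscreteDobrushin) (p : Site 2 × Fin 2) : ℝ :=
  max (Metric.infDist (medialPoint E.δ (mv p)) E.Ωᶜ) E.δ

/-- The DEFECT PROFILE with exponent `pz`: `(δ / depth)^{pz} × touchProb (midpoint, depth / 2)` —
the shape a `pz`-arm surgery bound takes RELATIVE to the probability that the interface comes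
within half the depth (in the boundary layer it is the bare touch probability). [folklore] -/
def defectProfile (E : DiscreteDobrushin) (pz : ℝ) (p : Site 2 × Fin 2) : ℝ :=
  (E.δ / edgeDepth E p) ^ pz * touchProb E (medialPoint E.δ (mv p)) (edgeDepth E p / 2)

/-- The `6δ`-DEEP sites of the Dobrushin domain `D` at mesh `δ` (as a set). [folklore] -/
def deepSet (D : DobrushinDomain) (δ : ℝ) : Set (Site 2) :=
  {x | Metric.closedBall (meshPoint δ x) (6 * δ) ⊆ D.carrier}

/-- The `6δ`-deep sites as a `Finset` (finite for `δ > 0` since `D` is bounded; junk `∅` else).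
This is the `Λ` on which the line runs Green's representation: its outer boundary is the
lattice layer within `7δ` of `∂D`, where `|g_q| ≤` touch probability is free. [folklore] -/
def deepSites (D : DobrushinDomain) (δ : ℝ) : Finset (Site 2) :=
  if h : (deepSet D δ).Finite then h.toFinset else ∅

/-- `κ = (2 cos (π/12))⁻¹`: at an interior passage the incoming and outgoing dart phases
`e^{-iW_in/3} + e^{-iW_out/3} = 2 cos(π/12) e^{-i·windingAt/3}` (`W_out = W_in ± π/2`). [folklore] -/
def kappa : ℝ := (2 * Real.cos (Real.pi / 12))⁻¹


/-! ### Glue (elementary, sorry-free) -/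

/-- The deep set is finite for a positive mesh (the domain is bounded). [folklore] -/
theorem deepSet_finite (D : DobrushinDomain) {δ : ℝ} (hδ : 0 < δ) : (deepSet D δ).Finite :=
  (meshVertices_finite D.isBounded hδ).subset fun x hx =>
    show meshPoint δ x ∈ D.carrier from hx (Metric.mem_closedBall_self (by positivity))

/-- Membership in `deepSites` for a positive mesh. [folklore] -/
theorem mem_deepSites (D : DobrushinDomain) {δ : ℝ} (hδ : 0 < δ) {x : Site 2} :
    x ∈ deepSites D δ ↔ Metric.closedBall (meshPoint δ x) (6 * δ) ⊆ D.carrier := by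
  rw [deepSites, dif_pos (deepSet_finite D hδ), Set.Finite.mem_toFinset]
  rfl

/-- An edge of the window of `x` has its base site within sup-distance `1` of `x`. [folklore] -/
theorem abs_le_of_mem_window {x : Site 2} {p : Site 2 × Fin 2} (hp : p ∈ window x) :
    |p.1 0 - x 0| ≤ 1 ∧ |p.1 1 - x 1| ≤ 1 := by
  simp only [window, Finset.mem_image, Finset.mem_univ, true_and] at hp
  obtain ⟨⟨a, b, j⟩, rfl⟩ := hp
  have ha := a.isLt
  have hb := b.isLt
  simp only [Pi.add_apply, Matrix.cons_val_zero, Matrix.cons_val_one]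
  constructor <;> rw [abs_le] <;> constructor <;> omega

/-- The midpoint of a window edge is within `4δ` of the window's centre. [folklore] -/
theorem dist_medialPoint_mv_le {δ : ℝ} (hδ : 0 ≤ δ) {x : Site 2} {p : Site 2 × Fin 2}
    (h0 : |p.1 0 - x 0| ≤ 1) (h1 : |p.1 1 - x 1| ≤ 1) :
    dist (medialPoint δ (mv p)) (meshPoint δ x) ≤ 4 * δ := by
  obtain ⟨y, j⟩ := p
  have h0' : |((y 0 : ℤ) : ℝ) - x 0| ≤ 1 := by exact_mod_cast h0
  have h1' : |((y 1 : ℤ) : ℝ) - x 1| ≤ 1 := by exact_mod_cast h1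
  obtain ⟨h0a, h0b⟩ := abs_le.1 h0'
  obtain ⟨h1a, h1b⟩ := abs_le.1 h1'
  rw [Complex.dist_eq]
  refine (Complex.norm_le_abs_re_add_abs_im _).trans ?_
  have hre : |(medialPoint δ (mv (y, j)) - meshPoint δ x).re| ≤ 2 * δ := by
    fin_cases j <;>
      simp [mv, ex, medialPoint_mk, meshPoint_re, Pi.add_apply] <;>
      rw [abs_le] <;> constructor <;> nlinarith
  have him : |(medialPoint δ (mv (y, j)) - meshPoint δ x).im| ≤ 2 * δ := by
    fin_cases j <;>
      simp [mv, ex, medialPoint_mk, meshPoint_im, Pi.add_apply] <;>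
      rw [abs_le] <;> constructor <;> nlinarith
  linarith

/-- The pivot of a class at a medial vertex is one of the two endpoints of the edge. [folklore] -/
theorem pivotOf_eq_or (x : Site 2) (i : Fin 2) (q : Fin 4) :
    pivotOf x i q = x ∨ pivotOf x i q = x + ex i := by
  fin_cases i <;> fin_cases q <;> simp [pivotOf]

/-- The pivot is within one mesh of the midpoint of the edge. [folklore] -/
theorem dist_pivotOf_le {δ : ℝ} (hδ : 0 ≤ δ) (x : Site 2) (i : Fin 2) (q : Fin 4) :
    dist (meshPoint δ (pivotOf x i q)) (medialPoint δ (mv (x, i))) ≤ δ := by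
  rw [Complex.dist_eq]
  refine (Complex.norm_le_abs_re_add_abs_im _).trans ?_
  have key : ∀ a b : ℝ, |a| ≤ δ / 2 → |b| ≤ δ / 2 → |a| + |b| ≤ δ := fun a b ha hb => by linarith
  apply key
  · rcases pivotOf_eq_or x i q with h | h <;> rw [h] <;> fin_cases i <;>
      simp [mv, ex, medialPoint_mk, meshPoint_re, Pi.add_apply] <;>
      first
        | (rw [abs_le]; constructor <;> nlinarith)
        | positivity
  · rcases pivotOf_eq_or x i q with h | h <;> rw [h] <;> fin_cases i <;>
      simp [mv, ex, medialPoint_mk, meshPoint_im, Pi.add_apply] <;>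
      first
        | (rw [abs_le]; constructor <;> nlinarith)
        | positivity

/-- `0 < κ ≤ 1` (`cos (π/12) ≥ cos (π/3) = 1/2`). [folklore] -/
theorem kappa_pos_le : 0 < kappa ∧ kappa ≤ 1 := by
  have hcos : (1:ℝ) / 2 ≤ Real.cos (Real.pi / 12) := by
    rw [← Real.cos_pi_div_three]
    exact Real.cos_le_cos_of_nonneg_of_le_pi (by positivity) (by linarith [Real.pi_pos])
      (by linarith [Real.pi_pos])
  have h2 : (1:ℝ) ≤ 2 * Real.cos (Real.pi / 12) := by linarith
  exact ⟨inv_pos.2 (by linarith), inv_le_one_of_one_le₀ h2⟩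

/-- `‖(κ : ℂ)‖ ≤ 1`. [folklore] -/
theorem norm_kappa_le : ‖(kappa : ℂ)‖ ≤ 1 := by
  rw [Complex.norm_real, Real.norm_of_nonneg kappa_pos_le.1.le]
  exact kappa_pos_le.2

/-- The Green-gradient weights are nonnegative. [folklore] -/
theorem greenWeight_nonneg (Λ : Finset (Site 2)) (x₀ : Site 2) (q : Fin 4) (p : Site 2 × Fin 2) :
    0 ≤ greenWeight Λ x₀ q p := add_nonneg (abs_nonneg _) (abs_nonneg _)

/-- The difference weights are nonnegative. [folklore] -/
theorem greenWeight₂_nonneg (Λ : Finset (Site 2)) (x₀ x₁ : Site 2) (q : Fin 4)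
    (p : Site 2 × Fin 2) : 0 ≤ greenWeight₂ Λ x₀ x₁ q p := add_nonneg (abs_nonneg _) (abs_nonneg _)



/-- Registered sub-goal `stub_kappaBounds` (the carrier obligation of this vocabulary file):
`0 < κ ≤ 1`. [folklore] -/
theorem stub_kappaBounds : 0 < kappa ∧ kappa ≤ 1 := kappa_pos_le

end Summit.CriticalPhenomena.CardyFormulaZ2.Cruxes.ParafermionPrecompact.KenyonStreamSecondRelation

end
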